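import Literature.MathematicalPhysics.QuantumFieldTheory.Balaban1983to89.B9SectBQSizesY
import Literature.MathematicalPhysics.QuantumFieldTheory.Balaban1983to89.B9SectBGWordDeltaAQY
import Literature.MathematicalPhysics.QuantumFieldTheory.Balaban1983to89.B9SectBCodedClassR

/-!
# Balaban [B9], (3.15) p. 393 for a GENERIC averaging pair `(𝔮, 𝔮s)` — the displayed size law `hQ15` of the K2-G frames REDUCED TO KERNEL DATA: block
# majorants of the coded letters `QbQC 𝔮 ∕ QsbQC 𝔮s` from a row-majorising kernel of `𝔮(U)` ∕ a column-majorising kernel of `𝔮s(U)` with support radius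
# and (volume-weighted) mass bounds (CASCADE-K piece «K2-G», stage L0: the packaging half of the knit suppliers)

T. Bałaban, *Propagators for lattice gauge theories in a background field*, Commun. Math. Phys. **99** (1985) 389–434
[`Balaban1985BackgroundPropagators`, "B9"]; [4] = [`Balaban1984PropagatorsII`]; [B8] = [`Balaban1985Averaging`].

statement-level skeleton of published theorems with citation tags; proofs where landed; nothing here is a claim about the Yang–Mills mass gap

THE PRINTED LOCUS.  (3.15) p. 393: the averaging operations `Q(U)`, `Q*(U)` are block-local with bounded kernels; for print's `Q` (= [B8] Prop. 2) the kernel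
bound holds on the small-field class (3.35) ([B7] Prop. 4), for the tree's straight letter `QY parB` unconditionally.

WHY THIS FILE (seat dag-n06-c gen 25; cell INBOX 2026-08-30 «K2-G-L1» offer; node00-def-Y CONCUR I.20317 on the guarded law shapes).  The K2-G constructors
(`B9SectBGFramesSelQY.gFrame₅CodedOnSelQ`, …) display `hQ15 : … Reg335 … → HasMajorant (blkC-keyed) (QbQC _ (𝔮 j) b (.base U)) (κQ·e^{−δd}) ∧ (QsbQC …)`.  Its
supplier at any pair is the SAME bookkeeping as `B9SectBQSizesY.hasMajorant_QbC ∕ hasMajorant_QsbC` once the pair's kernels are majorised; this file does that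
bookkeeping ONCE, for an abstract pair, so that a supplier (straight: r03's `qK`; knit: dag-n06-l's `norm_QknitY_apply_le_sum_knitRow` rows + my g23
`norm_QknitY_apply_le_of_reg335P`) only proves KERNEL facts: ★★ `hasMajorant_QbQC_of_rowKernel` — if `‖(𝔮(U)Λ)(κ)‖ ≦ Σ_f k(κ,f)‖Λ(f)‖` with `k ≧ 0`, rows
`Σ_f k(κ,f) ≦ C` and support `k(κ,f) ≠ 0 ⟹ dist(block of κ's representative, block of f) ≦ r` (blocks labelled by the section `ιB`), then `QbQC 𝔮 b (base U) ≺
(M₂Σ‖b_j‖)·C·e^{δr}·e^{−δd}` for every `δ ≧ 0`; ★★ `hasMajorant_QsbQC_of_colKernel` — if `‖(𝔮s(U)Ψ)(f)‖ ≦ Σ_κ k(κ,f)‖Ψ(κ)‖`, VOLUME-WEIGHTED columns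
`Σ_κ vol(κ)·k(κ,f) ≦ C` (print's weighted adjoint: `QsbQC = conj b (𝔮s ∘ diag(vol) ∘ res)`) and the same support, then `QsbQC 𝔮s b (base U) ≺ (M₂Σ‖b_j‖)·C·e^{δr}·e^{−δd}`.
§2 ★ `hQ15_of_kernels`: the two, under the member's (3.35) guard, packaged in EXACTLY the binder shape `hQ15` of the K2-G constructors (`δ ≦ 1 ⟹ e^{δr} ≦ e^{r}`).

HONEST SCOPE.  Finite-dimensional bookkeeping over DEFINED objects; the kernel bounds are HYPOTHESES; nothing of [B9] asserted; count-neutral; N06 NOT discharged;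
nothing continuum ∕ OS ∕ mass-gap ∕ Clay.  0 `def`, 0 `sorry`.  `--supports stmt-QuantumFields-27364`.

RELATED IN THE TREE, NOT DUPLICATED: `B9SectBQSizesY` (the straight instance with `k := |qK|`, whose tools `hasMajorant_conj_of_liftY_bound`, `bondFunCoordsY_symm_liftY`,
`norm_real_smul_le`, `one_le_exp_mul_exp_neg` are USED), `B9SectBGWordDeltaAQY` (the letters), dag-n06-l's `…N06Thm312313ParLawsQRow ∕ QStar` (the knit kernels on the
Sect.-D carrier — the intended suppliers here).
-/

noncomputable section

namespace Literature.MathematicalPhysics.QuantumFieldTheory.Balaban1983to89.B9SectBQLawsOfKernelY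

open Literature.MathematicalPhysics.QuantumFieldTheory.Balaban1983to89
open Literature.MathematicalPhysics.QuantumFieldTheory.Balaban1983to89.Node00 (SiteY BlkY FBondY IBondY CfgY liftY liftMatY liftMatY_diagonal_apply extBondY resBondY
  repBondY bondCoordsY bondFunCoordsY extBondY_apply_repBondY extBondY_apply_of_not_mem_range resBondY_apply bondCoordsY_apply)
open Literature.MathematicalPhysics.QuantumFieldTheory.Balaban1983to89.B6Ineq2142KLevelV1 (β)
open Literature.MathematicalPhysics.QuantumFieldTheory.Balaban1983to89.B6KLevelCensusIndexV1 (KIdx kGeo)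
open Literature.MathematicalPhysics.QuantumFieldTheory.Balaban1983to89.B6RandomWalk (HasMajorant hasMajorant_mono)
open Literature.MathematicalPhysics.QuantumFieldTheory.Balaban1983to89.B9Thm34Ext (toB6)
open Literature.MathematicalPhysics.QuantumFieldTheory.Balaban1983to89.B9GeoNormsKLevelV1 (geo9K)
open Literature.MathematicalPhysics.QuantumFieldTheory.Balaban1983to89.B9GeoLemma21KLevelV1 (geo9K_dist_comm)
open Literature.MathematicalPhysics.QuantumFieldTheory.Balaban1983to89.B9PinMembersKLevelV1 (MemberY geo9Y)
open Literature.MathematicalPhysics.QuantumFieldTheory.Balaban1983to89.B9Eq352DivFormLetters (conj)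
open Literature.MathematicalPhysics.QuantumFieldTheory.Balaban1983to89.B9Eq360DeltaPrimeAY (blkY AfldY)
open Literature.MathematicalPhysics.QuantumFieldTheory.Balaban1983to89.B9SectBGpLettersY (GVal decY decY_base blkC)
open Literature.MathematicalPhysics.QuantumFieldTheory.Balaban1983to89.B9SectBGpReadingsY (hasMajorant_conj_of_liftY_bound)
open Literature.MathematicalPhysics.QuantumFieldTheory.Balaban1983to89.B9SectBCodedCarrier (CCfg)
open Literature.MathematicalPhysics.QuantumFieldTheory.Balaban1983to89.B9SectBGWordDeltaAY (bondOpCoordsRY bondOpCoordsRY_apply restrictScalars_bondOpCoordsY volY volY_pos)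
open Literature.MathematicalPhysics.QuantumFieldTheory.Balaban1983to89.B9SectBGWordDeltaAQY (QbQY QsbVQY QbQC QsbQC)
open Literature.MathematicalPhysics.QuantumFieldTheory.Balaban1983to89.B9SectBGReadCodedY (hasMajorant_of_eq)
open Literature.MathematicalPhysics.QuantumFieldTheory.Balaban1983to89.B9SectBQSizesY (bondFunCoordsY_symm_liftY norm_real_smul_le one_le_exp_mul_exp_neg)

variable {d ℓ : ℕ} {hd : 1 ≤ d + 1} {hL : Odd (ℓ + 1) ∧ 1 < ℓ + 1} {b₀ b₁ : ℝ}
variable {𝔸 : Type} [NormedRing 𝔸] [NormedAlgebra ℂ 𝔸] [CompleteSpace 𝔸]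
variable {ι : Type} [Fintype ι]
variable (i : KIdx d ℓ hd hL b₀ b₁) (𝔮 : CfgY 𝔸 i → ((FBondY i → 𝔸) →ₗ[ℂ] (IBondY i → 𝔸)))
  (𝔮s : CfgY 𝔸 i → ((IBondY i → 𝔸) →ₗ[ℂ] (FBondY i → 𝔸))) (b : Module.Basis ι ℝ 𝔸) (ιB : BlkY i → IBondY i)
  [Fintype (geo9K i).Site] {Rr : ℝ} {Hp : Prop}

/-! ## §1 ★★ Kernel data ⟹ block majorants of the coded letters `QbQC 𝔮`, `QsbQC 𝔮s` -/

/-- ★★ **ROW KERNEL ⟹ (3.15) BLOCK MAJORANT OF `Qb = 𝔮(U)` READ ON FINE BONDS**: if `‖(𝔮(U)Λ)(κ)‖ ≦ Σ_f k(κ,f)·‖Λ(f)‖` for a nonnegative kernel `k` with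
row sums `≦ C` whose support keeps the labelled block of `f` within `r` of the labelled block of `κ`'s representative bond, then for every `δ ≧ 0`
`QbQC 𝔮 b (base U) ≺ (M₂Σ_j‖b_j‖)·C·e^{δr}·e^{−δ·d}` (block map `blkC ι_B ∘ snd ∘ fst`) — `B9SectBQSizesY.hasMajorant_QbC`'s bookkeeping with the kernel abstracted.
[cite: Balaban1985BackgroundPropagators, (3.12)–(3.15) pp.392–393; Balaban1984PropagatorsII, (2.51) p.232] -/
theorem hasMajorant_QbQC_of_rowKernel {M₂ : ℝ} (hM₂ : 0 ≤ M₂) (hrepr : ∀ (v : 𝔸) (j : ι), |b.repr v j| ≤ M₂ * ‖v‖) {U : CfgY 𝔸 i}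
    (k : IBondY i → FBondY i → ℝ) (hk : ∀ κ f, 0 ≤ k κ f)
    (hrow : ∀ (Λ : FBondY i → 𝔸) (κ : IBondY i), ‖𝔮 U Λ κ‖ ≤ ∑ f, k κ f * ‖Λ f‖)
    {C r : ℝ} (hC : 0 ≤ C) (hsum : ∀ κ, ∑ f, k κ f ≤ C)
    (hsupp : ∀ κ f, k κ f ≠ 0 →
      (geo9K i).dist (blkC i ιB (B6GlobalChartV1.boxEquiv i.hN (repBondY i κ).src)) (blkC i ιB (B6GlobalChartV1.boxEquiv i.hN f.src)) ≤ r)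
    {δ : ℝ} (hδ : 0 ≤ δ) :
    HasMajorant (g := toB6 (geo9K i) Rr Hp) (fun q : (Fin (d + 1) × SiteY i) × ι => blkC i ιB q.1.2) (QbQC i 𝔮 b (.base U))
      (fun a a' => (M₂ * ∑ j, ‖b j‖) * (C * Real.exp (δ * r) * Real.exp (-(δ * (geo9K i).dist a a')))) := by
  classical
  have hQ : QbQC i 𝔮 b (.base U) = conj b (bondOpCoordsRY i ((QbQY i 𝔮 U).restrictScalars ℝ)) := by
    rw [QbQC, restrictScalars_bondOpCoordsY, decY_base]
  refine hasMajorant_of_eq i hQ (hasMajorant_conj_of_liftY_bound b (g := toB6 (geo9K i) Rr Hp) (fun z : Fin (d + 1) × SiteY i => blkC i ιB z.2)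
    _ _ M₂ hM₂ hrepr fun f E y' B hE hB hoff hbd z => ?_)
  rw [bondOpCoordsRY_apply, LinearMap.restrictScalars_apply, Node00.bondFunCoordsY_apply]
  set Λ : FBondY i → 𝔸 := (bondFunCoordsY i).symm (liftY f E) with hΛ
  have hΛle : ∀ f'' : FBondY i, ‖Λ f''‖ ≤ |f (bondCoordsY i f'')| := fun f'' => by
    rw [hΛ, bondFunCoordsY_symm_liftY]; exact norm_real_smul_le hE
  have hK0 : 0 ≤ C * Real.exp (δ * r) * Real.exp (-(δ * (geo9K i).dist (blkC i ιB z.2) y')) * B := by positivity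
  by_cases hz : (bondCoordsY i).symm z ∈ Set.range (repBondY i)
  · obtain ⟨κ, hκ⟩ := hz
    have hval : QbQY i 𝔮 U Λ ((bondCoordsY i).symm z) = 𝔮 U Λ κ := by
      rw [← hκ]; simp only [QbQY, LinearMap.comp_apply, extBondY_apply_repBondY]
    rw [hval]
    have hz2 : z.2 = B6GlobalChartV1.boxEquiv i.hN (repBondY i κ).src := by
      have : z = bondCoordsY i (repBondY i κ) := by rw [hκ, Equiv.apply_symm_apply]
      rw [this, bondCoordsY_apply]
    by_cases hex : ∃ f' : FBondY i, k κ f' ≠ 0 ∧ blkC i ιB (B6GlobalChartV1.boxEquiv i.hN f'.src) = y'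
    · obtain ⟨f', hf', hy'⟩ := hex
      have hdist : (geo9K i).dist (blkC i ιB z.2) y' ≤ r := by rw [hz2, ← hy']; exact hsupp κ f' hf'
      have hS : ‖𝔮 U Λ κ‖ ≤ C * B :=
        calc ‖𝔮 U Λ κ‖ ≤ ∑ f'', k κ f'' * ‖Λ f''‖ := hrow Λ κ
          _ ≤ ∑ f'', k κ f'' * B := Finset.sum_le_sum fun f'' _ => mul_le_mul_of_nonneg_left ((hΛle f'').trans (hbd _)) (hk κ f'')
          _ = (∑ f'', k κ f'') * B := by rw [Finset.sum_mul]
          _ ≤ C * B := mul_le_mul_of_nonneg_right (hsum κ) hB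
      calc ‖𝔮 U Λ κ‖ ≤ C * B := hS
        _ = C * 1 * B := by rw [mul_one]
        _ ≤ C * (Real.exp (δ * r) * Real.exp (-(δ * (geo9K i).dist (blkC i ιB z.2) y'))) * B := by
            gcongr; exact one_le_exp_mul_exp_neg hδ hdist
        _ = _ := by ring
    · have hS : ‖𝔮 U Λ κ‖ ≤ 0 := by
        refine (hrow Λ κ).trans (le_of_eq (Finset.sum_eq_zero fun f'' _ => ?_))
        by_cases hkf : k κ f'' = 0
        · rw [hkf, zero_mul]
        · have hoff' : f (bondCoordsY i f'') = 0 := by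
            refine hoff _ fun h => hex ⟨f'', hkf, ?_⟩
            rw [← h, bondCoordsY_apply]
          have hΛ0 : Λ f'' = 0 := by rw [hΛ, bondFunCoordsY_symm_liftY, hoff', Complex.ofReal_zero, zero_smul]
          rw [hΛ0, norm_zero, mul_zero]
      exact hS.trans hK0
  · have hval : QbQY i 𝔮 U Λ ((bondCoordsY i).symm z) = 0 := by
      simp only [QbQY, LinearMap.comp_apply]; exact extBondY_apply_of_not_mem_range i _ hz
    rw [hval, norm_zero]; exact hK0

/-- ★★ **COLUMN KERNEL ⟹ (3.15) BLOCK MAJORANT OF `Qsb = 𝔮s(U)·vol` READ ON FINE BONDS** (print's weighted adjoint, `QsbQC = conj b (𝔮s(U) ∘ diag(vol) ∘ res)`):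
if `‖(𝔮s(U)Ψ)(f)‖ ≦ Σ_κ k(κ,f)·‖Ψ(κ)‖` for a nonnegative kernel `k` with VOLUME-WEIGHTED column sums `Σ_κ vol(κ)·k(κ,f) ≦ C` and the same support law, then for every
`δ ≧ 0` `QsbQC 𝔮s b (base U) ≺ (M₂Σ_j‖b_j‖)·C·e^{δr}·e^{−δ·d}` — `B9SectBQSizesY.hasMajorant_QsbC`'s bookkeeping with the kernel abstracted.
[cite: Balaban1985BackgroundPropagators, (3.13)–(3.15) pp.392–393; Balaban1984PropagatorsII, (2.51) p.232] -/
theorem hasMajorant_QsbQC_of_colKernel {M₂ : ℝ} (hM₂ : 0 ≤ M₂) (hrepr : ∀ (v : 𝔸) (j : ι), |b.repr v j| ≤ M₂ * ‖v‖) {U : CfgY 𝔸 i}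
    (k : IBondY i → FBondY i → ℝ) (hk : ∀ κ f, 0 ≤ k κ f)
    (hcol : ∀ (Ψ : IBondY i → 𝔸) (f : FBondY i), ‖𝔮s U Ψ f‖ ≤ ∑ κ, k κ f * ‖Ψ κ‖)
    {C r : ℝ} (hC : 0 ≤ C) (hsumV : ∀ f, ∑ κ, volY i κ * k κ f ≤ C)
    (hsupp : ∀ κ f, k κ f ≠ 0 →
      (geo9K i).dist (blkC i ιB (B6GlobalChartV1.boxEquiv i.hN (repBondY i κ).src)) (blkC i ιB (B6GlobalChartV1.boxEquiv i.hN f.src)) ≤ r)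
    {δ : ℝ} (hδ : 0 ≤ δ) :
    HasMajorant (g := toB6 (geo9K i) Rr Hp) (fun q : (Fin (d + 1) × SiteY i) × ι => blkC i ιB q.1.2) (QsbQC i 𝔮s b (.base U))
      (fun a a' => (M₂ * ∑ j, ‖b j‖) * (C * Real.exp (δ * r) * Real.exp (-(δ * (geo9K i).dist a a')))) := by
  classical
  have hQ : QsbQC i 𝔮s b (.base U) = conj b (bondOpCoordsRY i ((QsbVQY i 𝔮s U).restrictScalars ℝ)) := by
    rw [QsbQC, restrictScalars_bondOpCoordsY, decY_base]
  refine hasMajorant_of_eq i hQ (hasMajorant_conj_of_liftY_bound b (g := toB6 (geo9K i) Rr Hp) (fun z : Fin (d + 1) × SiteY i => blkC i ιB z.2)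
    _ _ M₂ hM₂ hrepr fun f E y' B hE hB hoff hbd z => ?_)
  rw [bondOpCoordsRY_apply, LinearMap.restrictScalars_apply, Node00.bondFunCoordsY_apply]
  set Λ : FBondY i → 𝔸 := (bondFunCoordsY i).symm (liftY f E) with hΛ
  set bd : FBondY i := (bondCoordsY i).symm z with hbd'
  have hz2 : z.2 = B6GlobalChartV1.boxEquiv i.hN bd.src := by
    have : z = bondCoordsY i bd := by rw [hbd', Equiv.apply_symm_apply]
    rw [this, bondCoordsY_apply]
  have hΛrep : ∀ κ, ‖Λ (repBondY i κ)‖ ≤ |f (bondCoordsY i (repBondY i κ))| := fun κ => by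
    rw [hΛ, bondFunCoordsY_symm_liftY]; exact norm_real_smul_le hE
  have hK0 : 0 ≤ C * Real.exp (δ * r) * Real.exp (-(δ * (geo9K i).dist (blkC i ιB z.2) y')) * B := by positivity
  -- the argument of `𝔮s(U)`: `Ψ κ = vol(κ) • Λ(rep κ)`
  set Ψ : IBondY i → 𝔸 := fun κ => ((volY i κ : ℝ) : ℂ) • Λ (repBondY i κ) with hΨ
  have hval : QsbVQY i 𝔮s U Λ bd = 𝔮s U Ψ bd := by
    have hΨ' : liftMatY 𝔸 (Matrix.diagonal (volY i)) (resBondY i Λ) = Ψ := funext fun κ => by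
      rw [liftMatY_diagonal_apply, resBondY_apply]
    simp only [QsbVQY, LinearMap.comp_apply, hΨ']
  have hΨle : ∀ κ, ‖Ψ κ‖ ≤ volY i κ * |f (bondCoordsY i (repBondY i κ))| := fun κ => by
    rw [hΨ]; dsimp only
    rw [norm_smul, Complex.norm_real, Real.norm_eq_abs, abs_of_pos (volY_pos i κ)]
    exact mul_le_mul_of_nonneg_left (hΛrep κ) (volY_pos i κ).le
  rw [hval]
  by_cases hex : ∃ κ, k κ bd ≠ 0 ∧ blkC i ιB (B6GlobalChartV1.boxEquiv i.hN (repBondY i κ).src) = y'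
  · obtain ⟨κ₀, hκ₀, hy'⟩ := hex
    have hdist : (geo9K i).dist (blkC i ιB z.2) y' ≤ r := by
      rw [hz2, ← hy', geo9K_dist_comm]; exact hsupp κ₀ bd hκ₀
    have hS : ‖𝔮s U Ψ bd‖ ≤ C * B :=
      calc ‖𝔮s U Ψ bd‖ ≤ ∑ κ, k κ bd * ‖Ψ κ‖ := hcol Ψ bd
        _ ≤ ∑ κ, k κ bd * (volY i κ * B) := Finset.sum_le_sum fun κ _ =>
            mul_le_mul_of_nonneg_left ((hΨle κ).trans (mul_le_mul_of_nonneg_left (hbd _) (volY_pos i κ).le)) (hk κ bd)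
        _ = (∑ κ, volY i κ * k κ bd) * B := by rw [Finset.sum_mul]; exact Finset.sum_congr rfl fun κ _ => by ring
        _ ≤ C * B := mul_le_mul_of_nonneg_right (hsumV bd) hB
    calc ‖𝔮s U Ψ bd‖ ≤ C * B := hS
      _ = C * 1 * B := by rw [mul_one]
      _ ≤ C * (Real.exp (δ * r) * Real.exp (-(δ * (geo9K i).dist (blkC i ιB z.2) y'))) * B := by
          gcongr; exact one_le_exp_mul_exp_neg hδ hdist
      _ = _ := by ring
  · have hS : ‖𝔮s U Ψ bd‖ ≤ 0 := by
      refine (hcol Ψ bd).trans (le_of_eq (Finset.sum_eq_zero fun κ _ => ?_))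
      by_cases hkf : k κ bd = 0
      · rw [hkf, zero_mul]
      · have hoff' : f (bondCoordsY i (repBondY i κ)) = 0 := by
          refine hoff _ fun h => hex ⟨κ, hkf, ?_⟩
          rw [← h, bondCoordsY_apply]
        have hΨ0 : Ψ κ = 0 := by
          rw [hΨ]; dsimp only
          rw [hΛ, bondFunCoordsY_symm_liftY, hoff', Complex.ofReal_zero, zero_smul, smul_zero]
        rw [hΨ0, norm_zero, mul_zero]
    exact hS.trans hK0

/-! ## §2 ★ The member-level packaging: kernel data on the (3.35) class ⟹ the K2-G binder `hQ15` verbatim -/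

section Members

open Literature.MathematicalPhysics.QuantumFieldTheory.Balaban1983to89.B9SectBCodedClassR (RegExtraY bg9YC)

variable {Mstar : ℕ} (P : RegExtraY d ℓ hd hL b₀ b₁ Mstar 𝔸) {J : Type} (f : J → MemberY d ℓ hd hL b₀ b₁ Mstar)
  [∀ x : MemberY d ℓ hd hL b₀ b₁ Mstar, Fintype (geo9Y x).Site]
  (c35 : ℝ) (G : Subgroup 𝔸ˣ)
  (𝔮f : ∀ j : J, CfgY 𝔸 (f j).toKIdx → ((FBondY (f j).toKIdx → 𝔸) →ₗ[ℂ] (IBondY (f j).toKIdx → 𝔸)))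
  (𝔮sf : ∀ j : J, CfgY 𝔸 (f j).toKIdx → ((IBondY (f j).toKIdx → 𝔸) →ₗ[ℂ] (FBondY (f j).toKIdx → 𝔸)))
  (ιBf : ∀ j : J, BlkY (f j).toKIdx → IBondY (f j).toKIdx)

/-- ★ **THE K2-G SIZE LAW `hQ15` FROM KERNEL DATA ON THE (3.35) CLASS**: if, for every member and every configuration `U` in the (3.35) class above the thresholds
`(MInv, aInv)`, the pair `(𝔮 j U, 𝔮s j U)` is majorised by nonnegative kernels `kQ j U ∕ kQs j U` (rows of `𝔮`, columns of `𝔮s`) with row mass `≦ C`, volume-weighted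
column mass `≦ C` and support radius `r ≧ 0` in the labelled blocks, then the binder `hQ15` of `B9SectBGFramesSelQY.gFrame₅CodedOnSelQ` holds VERBATIM with
`κQ := (M₂Σ_j‖b_j‖)·C·e^{r}` (`δ ≦ 1`).  Straight supplier: r03's `qK` facts (`B9SectBQSizesY`); knit supplier: dag-n06-l's `norm_QknitY_apply_le_sum_knitRow` rows
+ `norm_adjTrY_apply_le_of_rowKernel` columns on (3.35). [cite: Balaban1985BackgroundPropagators, (3.15) p.393, (3.35) p.396; Balaban1985Averaging, Prop. 2 p.26; Balaban1984PropagatorsII, (2.51) p.232] -/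
theorem hQ15_of_kernels {M₂ : ℝ} (hM₂ : 0 ≤ M₂) (hrepr : ∀ (v : 𝔸) (j : ι), |b.repr v j| ≤ M₂ * ‖v‖) (MInv aInv : ℝ)
    {C r : ℝ} (hC : 0 ≤ C) (hr : 0 ≤ r)
    (kQ kQs : ∀ j : J, CfgY 𝔸 (f j).toKIdx → IBondY (f j).toKIdx → FBondY (f j).toKIdx → ℝ)
    (hker : ∀ j (α₀ : ℝ) (U : CfgY 𝔸 (f j).toKIdx), MInv ≤ (geo9Y (f j)).M → 0 < α₀ → (geo9Y (f j)).M * α₀ ≤ aInv →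
      (bg9YC 𝔸 G P (f j)).Reg335 c35 α₀ U →
      (∀ κ f', 0 ≤ kQ j U κ f') ∧ (∀ (Λ : FBondY (f j).toKIdx → 𝔸) κ, ‖𝔮f j U Λ κ‖ ≤ ∑ f', kQ j U κ f' * ‖Λ f'‖) ∧
        (∀ κ, ∑ f', kQ j U κ f' ≤ C) ∧
        (∀ κ f', kQ j U κ f' ≠ 0 → (geo9K (f j).toKIdx).dist (blkC (f j).toKIdx (ιBf j) (B6GlobalChartV1.boxEquiv (f j).toKIdx.hN (repBondY (f j).toKIdx κ).src))
          (blkC (f j).toKIdx (ιBf j) (B6GlobalChartV1.boxEquiv (f j).toKIdx.hN f'.src)) ≤ r) ∧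
      (∀ κ f', 0 ≤ kQs j U κ f') ∧ (∀ (Ψ : IBondY (f j).toKIdx → 𝔸) f', ‖𝔮sf j U Ψ f'‖ ≤ ∑ κ, kQs j U κ f' * ‖Ψ κ‖) ∧
        (∀ f', ∑ κ, volY (f j).toKIdx κ * kQs j U κ f' ≤ C) ∧
        (∀ κ f', kQs j U κ f' ≠ 0 → (geo9K (f j).toKIdx).dist (blkC (f j).toKIdx (ιBf j) (B6GlobalChartV1.boxEquiv (f j).toKIdx.hN (repBondY (f j).toKIdx κ).src))
          (blkC (f j).toKIdx (ιBf j) (B6GlobalChartV1.boxEquiv (f j).toKIdx.hN f'.src)) ≤ r)) :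
    ∀ j (α₀ : ℝ) (U : CfgY 𝔸 (f j).toKIdx) (δ : ℝ), MInv ≤ (geo9Y (f j)).M → 0 < α₀ → (geo9Y (f j)).M * α₀ ≤ aInv →
      (bg9YC 𝔸 G P (f j)).Reg335 c35 α₀ U → 0 < δ → δ ≤ 1 →
      HasMajorant (g := toB6 (geo9Y (f j)) 0 True) (fun q : (Fin (d + 1) × SiteY (f j).toKIdx) × ι => blkC (f j).toKIdx (ιBf j) q.1.2)
          (QbQC (f j).toKIdx (𝔮f j) b (.base U)) (fun a a' => ((M₂ * ∑ j, ‖b j‖) * (C * Real.exp r)) * Real.exp (-(δ * (geo9Y (f j)).dist a a'))) ∧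
        HasMajorant (g := toB6 (geo9Y (f j)) 0 True) (fun q : (Fin (d + 1) × SiteY (f j).toKIdx) × ι => blkC (f j).toKIdx (ιBf j) q.1.2)
          (QsbQC (f j).toKIdx (𝔮sf j) b (.base U)) (fun a a' => ((M₂ * ∑ j, ‖b j‖) * (C * Real.exp r)) * Real.exp (-(δ * (geo9Y (f j)).dist a a'))) := by
  intro j α₀ U δ hM hα₀ hMa hU hδ hδ1
  letI : Fintype (geo9K (f j).toKIdx).Site := ‹∀ x : MemberY d ℓ hd hL b₀ b₁ Mstar, Fintype (geo9Y x).Site› (f j)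
  obtain ⟨hk0, hrow, hsum, hsupp, hks0, hcol, hsumV, hsupps⟩ := hker j α₀ U hM hα₀ hMa hU
  have hMS : 0 ≤ M₂ * ∑ j, ‖b j‖ := mul_nonneg hM₂ (Finset.sum_nonneg fun j _ => norm_nonneg _)
  have her : Real.exp (δ * r) ≤ Real.exp r := Real.exp_le_exp.2 (by nlinarith)
  have hup : ∀ a a' : (geo9K (f j).toKIdx).Site,
      (M₂ * ∑ j, ‖b j‖) * (C * Real.exp (δ * r) * Real.exp (-(δ * (geo9K (f j).toKIdx).dist a a'))) ≤
        ((M₂ * ∑ j, ‖b j‖) * (C * Real.exp r)) * Real.exp (-(δ * (geo9K (f j).toKIdx).dist a a')) := fun a a' => by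
    have h0 : 0 ≤ Real.exp (-(δ * (geo9K (f j).toKIdx).dist a a')) := (Real.exp_pos _).le
    calc (M₂ * ∑ j, ‖b j‖) * (C * Real.exp (δ * r) * Real.exp (-(δ * (geo9K (f j).toKIdx).dist a a')))
        = (M₂ * ∑ j, ‖b j‖) * C * Real.exp (δ * r) * Real.exp (-(δ * (geo9K (f j).toKIdx).dist a a')) := by ring
      _ ≤ (M₂ * ∑ j, ‖b j‖) * C * Real.exp r * Real.exp (-(δ * (geo9K (f j).toKIdx).dist a a')) := by gcongr
      _ = _ := by ring
  exact ⟨hasMajorant_mono _ (hasMajorant_QbQC_of_rowKernel (Rr := 0) (Hp := True) (f j).toKIdx (𝔮f j) b (ιBf j) hM₂ hrepr (kQ j U) hk0 hrow hC hsum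
      hsupp hδ.le) hup,
    hasMajorant_mono _ (hasMajorant_QsbQC_of_colKernel (Rr := 0) (Hp := True) (f j).toKIdx (𝔮sf j) b (ιBf j) hM₂ hrepr (kQs j U) hks0 hcol hC hsumV
      hsupps hδ.le) hup⟩

end Members

end Literature.MathematicalPhysics.QuantumFieldTheory.Balaban1983to89.B9SectBQLawsOfKernelY

end
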